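import Summits.QuantumFields.BalabanUV.Beta.GAN24.GaugeTableSlotByParts

/-!
# `BalabanUV.Beta.GAN24.GaugeTableCellByParts` — binder row G-an2-4 ∕ (CONV-C), W-slot CT-W, route «WC-TL» ∕ «QR-LL», row **(LT-Δ) «LAYER TRANSPORT»**, K-LL-4:
# **THE BINDER-FREE (b3) CELL COUNT**: the table-gauge cell of `push₃` through ANY letter family obeying the (LAY) profile row is bounded by the two kernel legs'
# sups, the letter's constant, two lattice exponential sums, and ONE displayed quantity — the `ℓ¹`-MASS OF THE GAUGE FUNCTION's EXCURSION `|λ_{νU} − c|` AGAINST THE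
# LETTER's SLOT WEIGHT `ω̃`: `|push₃ l r (dz∘λ) S ν U x′ z′ (inl α)(inl β)| ≤ (d+1)²·Cl·Cr·Cs·Zl(m′)²·Σ'_u |λ_{νU}(u) − c|·ω̃(u)`

NOT IN PRINT; OUR BOOKKEEPING ([folklore] `GaugeTableSlotByParts.abs_vertexW_dz_le_of_profile` through `Push3.push₃_inl_inl` with two Fubini exchanges of non-negative
double series; G-an2-4 formalisation swarm, leaf prover `b2b-balaban-gan24-formalise-leaf-01`, gen 66).  HONEST FRAMING (cell contract, verbatim): «discharging `BetaPertH`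
makes Bałaban's UV stability UNCONDITIONAL — a real constructive-QFT result; it is NOT the continuum limit and NOT the Clay problem.»  HONEST DEPENDENCY (verbatim):
«continuum YM on T⁴ ⇐ BetaPertH ∧ nine spine estimates (0/9 proved); BetaPertH ⇐ (D1) ∧ (D4) ∧ CAP+tail; G-an2-4 gates asym, D1 and NE2/3/4.»

## What (generic `d`; kernel legs bounded by `Cl`, `Cr`; gauge functions bounded by `Lbar`; letter family under the profile row
## `|S κ u x z a b| ≤ Cs·ω u·e^{−m′(‖x−u‖₁+‖z−u‖₁)}` with `0 < m′`, `0 ≤ ω ≤ Ω`; `ω̃ u := e^{2m′}·Σ_κ ω(u − e_κ) + (d+1)·ω u`)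
§1 Fubini bricks for the non-negative kernel `F(x,u) = a(u)·e^{−m′‖x−u‖₁}·e^{−m′‖z−u‖₁}` (`summable_F`, `tsum_tsum_F`).
§2 **`abs_push₃_dz_le_slotMass`**: for every `c`, if `u ↦ |λ_{νU}(u) − c|·ω̃(u)` is summable then
   `|push₃ l r (dz∘λ) S ν U x′ z′ (inl α)(inl β)| ≤ (d+1)²·Cl·Cr·Cs·Zl(m′)²·Σ'_u |λ_{νU}(u) − c|·ω̃(u)`.
READING (displayed, not claimed beyond the theorem): with the cubic weight `L^{3(d+1)}`, (N1)-sized kernel legs `Cl = Cr = A·L^{−(d+2)}` and `c` the gauge function's value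
on the block side of the letter's layer, the right side is `L^{3(d+1)}·A²·L^{−2(d+2)}·Cs·Zl²·(JUMP across ∂Y)·(slot weight of the far side ≍ 2(d+1)·L^d)` = my R-1 count
`≍ A³·Cs·L^{d−2}` — an UPPER bound; whether the literal saturates it is the structural question (a)/(b)/(c) of R-1, not decided here.  K-LL-4 NOT advanced.
[folklore]; 0 cited facts, 0 `def`, 0 `def … : Prop`, 0 sorry.  NOTHING of (Q-R)∕(LT)∕(Q-L)∕(C)∕(S)∕«T2Shape»∕«T2Drift»∕(hW, hWall) discharged; NEVER «G-an2-4 closed» as (CONV-C);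
NOT D1, NOT `BetaPertH`, NOT continuum, NOT Clay.  2026-08-22; no existing file touched.
-/

noncomputable section

open Finset
open scoped BigOperators
open Literature.MathematicalPhysics.QuantumFieldTheory
open Literature.MathematicalPhysics.QuantumFieldTheory.Balaban1983to89
open Literature.MathematicalPhysics.QuantumFieldTheory.Balaban1983to89.Beta
open B12Sec2to5 (l1 l1_nonneg)
open ExpKernelCalculus (MKer Site Zl Zl_nonneg summable_exp_shift tsum_exp_shift)
open OneStepResolventKernel (Fib)
open AffineAveraging (dz)
open KernelWard (divV)
open Summit.QuantumFields.BalabanUV.Beta.GAN24.Push4 (vertexW vertexW_apply)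
open Summit.QuantumFields.BalabanUV.Beta.GAN24.Push3 (push₃ push₃_inl_inl)
open Summit.QuantumFields.BalabanUV.Beta.GAN24.GaugeTableSlotByParts (abs_vertexW_dz_le_of_profile)

namespace Summit.QuantumFields.BalabanUV.Beta.GAN24.GaugeTableCellByParts

variable {d : ℕ}

/-! ## §1 Fubini bricks -/

section Fubini

variable {a : Site (d + 1) → ℝ} {m' : ℝ} (hm : 0 < m') (ha : ∀ u, 0 ≤ a u) (has : Summable a)

include hm ha has in
/-- [folklore] `(u, x) ↦ a(u)·e^{−m′‖x−u‖₁}·w(u)` with `0 ≤ w ≤ 1` is summable on `Site × Site` (non-negative; fibres are shifted exponential sums; the marginal is `≤ Zl(m′)·a`). -/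
theorem summable_prod_weight {w : Site (d + 1) → ℝ} (hw0 : ∀ u, 0 ≤ w u) (hw1 : ∀ u, w u ≤ 1) :
    Summable fun p : Site (d + 1) × Site (d + 1) => a p.1 * Real.exp (-m' * l1 (p.2 - p.1)) * w p.1 := by
  have hnn : ∀ p : Site (d + 1) × Site (d + 1), 0 ≤ a p.1 * Real.exp (-m' * l1 (p.2 - p.1)) * w p.1 :=
    fun p => mul_nonneg (mul_nonneg (ha _) (Real.exp_nonneg _)) (hw0 _)
  refine (summable_prod_of_nonneg hnn).2 ⟨fun u => ?_, ?_⟩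
  · have h := (summable_exp_shift (D := d + 1) hm u).mul_left (a u)
    have h' := h.mul_right (w u)
    refine h'.congr fun x => ?_
    simp only [ExpKernelCalculus.l1_sub_symm x u]
  · have e : (fun u => ∑' x : Site (d + 1), a u * Real.exp (-m' * l1 (x - u)) * w u) = fun u => a u * (Zl (d + 1) m' * w u) := by
      funext u
      rw [show (fun x : Site (d + 1) => a u * Real.exp (-m' * l1 (x - u)) * w u) = fun x => (a u * w u) * Real.exp (-m' * l1 (u - x)) from
        funext fun x => by rw [ExpKernelCalculus.l1_sub_symm x u]; ring, tsum_mul_left, tsum_exp_shift]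
      ring
    rw [e]
    refine Summable.of_norm_bounded (has.mul_right (Zl (d + 1) m')) (fun u => ?_)
    rw [Real.norm_eq_abs, abs_of_nonneg (mul_nonneg (ha u) (mul_nonneg (Zl_nonneg hm) (hw0 u)))]
    calc a u * (Zl (d + 1) m' * w u) ≤ a u * Zl (d + 1) m' :=
          mul_le_mul_of_nonneg_left (mul_le_of_le_one_right (Zl_nonneg hm) (hw1 u)) (ha u)
      _ = a u * Zl (d + 1) m' := rfl

include hm ha has in
/-- [folklore] **FUBINI FOR THE WEIGHTED EXPONENTIAL KERNEL**: `Σ'_x Σ'_u a(u)·e^{−m′‖x−u‖₁}·w(u) = Zl(m′)·Σ'_u a(u)·w(u)` (`0 ≤ w ≤ 1`), together with the summability of the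
inner and outer series. -/
theorem tsum_tsum_weight {w : Site (d + 1) → ℝ} (hw0 : ∀ u, 0 ≤ w u) (hw1 : ∀ u, w u ≤ 1) :
    (∀ x, Summable fun u => a u * Real.exp (-m' * l1 (x - u)) * w u) ∧
    (Summable fun x => ∑' u, a u * Real.exp (-m' * l1 (x - u)) * w u) ∧
    ∑' x : Site (d + 1), ∑' u : Site (d + 1), a u * Real.exp (-m' * l1 (x - u)) * w u = Zl (d + 1) m' * ∑' u, a u * w u := by
  have hs := summable_prod_weight hm ha has hw0 hw1
  refine ⟨fun x => hs.prod_symm.prod_factor x, hs.prod_symm.prod, ?_⟩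
  have hs' : Summable (Function.uncurry fun u x => a u * Real.exp (-m' * l1 (x - u)) * w u) := hs
  rw [hs'.tsum_comm]
  have e : ∀ u, ∑' x : Site (d + 1), a u * Real.exp (-m' * l1 (x - u)) * w u = a u * w u * Zl (d + 1) m' := by
    intro u
    rw [show (fun x : Site (d + 1) => a u * Real.exp (-m' * l1 (x - u)) * w u) = fun x => (a u * w u) * Real.exp (-m' * l1 (u - x)) from
      funext fun x => by rw [ExpKernelCalculus.l1_sub_symm x u]; ring, tsum_mul_left, tsum_exp_shift]
  rw [tsum_congr e, tsum_mul_right, mul_comm]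

include hm ha has in
/-- [folklore] The unweighted case: `Σ'_z Σ'_u a(u)·e^{−m′‖z−u‖₁} = Zl(m′)·Σ'_u a(u)` with the summability of the inner and outer series. -/
theorem tsum_tsum_one :
    (∀ z, Summable fun u => a u * Real.exp (-m' * l1 (z - u))) ∧
    (Summable fun z => ∑' u, a u * Real.exp (-m' * l1 (z - u))) ∧
    ∑' z : Site (d + 1), ∑' u : Site (d + 1), a u * Real.exp (-m' * l1 (z - u)) = Zl (d + 1) m' * ∑' u, a u := by
  obtain ⟨h1, h2, h3⟩ := tsum_tsum_weight (w := fun _ => (1 : ℝ)) hm ha has (fun _ => zero_le_one) (fun _ => le_rfl)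
  simp only [mul_one] at h1 h2 h3
  exact ⟨h1, h2, h3⟩

end Fubini

/-! ## §2 The binder-free (b3) cell count -/

section Cell

variable {l r : Fin (d + 1) → Site (d + 1) → Fin (d + 1) → Site (d + 1) → ℝ}
  {S : Fin (d + 1) → Site (d + 1) → MKer (d + 1) (Fib d)} {lam : Fin (d + 1) → Site (d + 1) → Site (d + 1) → ℝ}
  {ω : Site (d + 1) → ℝ} {Cl Cr Cs m' Ω Lbar : ℝ}
  (hl : ∀ α x' κ x, |l α x' κ x| ≤ Cl) (hr : ∀ β z' κ z, |r β z' κ z| ≤ Cr) (hCl : 0 ≤ Cl)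
  (hlam : ∀ ν U u, |lam ν U u| ≤ Lbar)
  (hCs : 0 ≤ Cs) (hm : 0 < m') (hω : ∀ u, 0 ≤ ω u ∧ ω u ≤ Ω)
  (hS : ∀ k' u x z a b, |S k' u x z a b| ≤ Cs * ω u * Real.exp (-m' * (l1 (x - u) + l1 (z - u))))

include hCs hm hω hS in
/-- [folklore] The profile row with a bounded weight makes the letter slot-summable at every kernel entry. -/
theorem summable_slot (κ : Fin (d + 1)) (x z : Site (d + 1)) (a b : Fib d) : Summable fun u => S κ u x z a b := by
  refine Summable.of_norm_bounded (((summable_exp_shift (D := d + 1) hm x).mul_left (Cs * Ω))) (fun u => ?_)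
  rw [Real.norm_eq_abs]
  refine (hS κ u x z a b).trans ?_
  have hE : Real.exp (-m' * (l1 (x - u) + l1 (z - u))) ≤ Real.exp (-m' * l1 (x - u)) :=
    Real.exp_le_exp.2 (by nlinarith [l1_nonneg (z - u)])
  calc Cs * ω u * Real.exp (-m' * (l1 (x - u) + l1 (z - u))) ≤ Cs * ω u * Real.exp (-m' * l1 (x - u)) :=
        mul_le_mul_of_nonneg_left hE (mul_nonneg hCs (hω u).1)
    _ ≤ Cs * Ω * Real.exp (-m' * l1 (x - u)) :=
        mul_le_mul_of_nonneg_right (mul_le_mul_of_nonneg_left (hω u).2 hCs) (Real.exp_nonneg _)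

include hl hr hCl hlam hCs hm hω hS in
/-- NOT IN PRINT; OUR BOOKKEEPING.  **THE BINDER-FREE (b3) CELL COUNT**: for every constant `c` with `u ↦ |λ_{νU}(u) − c|·ω̃(u)` summable,
`|push₃ l r (dz∘lam) S ν U x′ z′ (inl α)(inl β)| ≤ (d+1)²·Cl·Cr·Cs·Zl(m′)²·Σ'_u |lam ν U u − c|·(e^{2m′}·Σ_κ ω(u−e_κ) + (d+1)·ω u)`. -/
theorem abs_push₃_dz_le_slotMass (ν : Fin (d + 1)) (U x' z' : Site (d + 1)) (α β : Fin (d + 1)) (c : ℝ)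
    (hmass : Summable fun u => |lam ν U u - c| * (Real.exp (2 * m') * (∑ κ : Fin (d + 1), ω (u - AffineAveraging.unitVec κ)) + ((d : ℝ) + 1) * ω u)) :
    |push₃ l r (fun ν U κ u => dz (lam ν U) κ u) S ν U x' z' (Sum.inl α) (Sum.inl β)|
      ≤ ((d : ℝ) + 1) ^ 2 * Cl * Cr * Cs * Zl (d + 1) m' ^ 2
        * ∑' u : Site (d + 1), |lam ν U u - c| * (Real.exp (2 * m') * (∑ κ : Fin (d + 1), ω (u - AffineAveraging.unitVec κ)) + ((d : ℝ) + 1) * ω u) := by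
  -- the slot mass density and its non-negativity
  set a : Site (d + 1) → ℝ := fun u => |lam ν U u - c| * (Real.exp (2 * m') * (∑ κ : Fin (d + 1), ω (u - AffineAveraging.unitVec κ)) + ((d : ℝ) + 1) * ω u) with ha_def
  have ha : ∀ u, 0 ≤ a u := fun u => mul_nonneg (abs_nonneg _)
    (add_nonneg (mul_nonneg (Real.exp_nonneg _) (Finset.sum_nonneg fun κ _ => (hω _).1)) (mul_nonneg (by positivity) (hω u).1))
  -- pointwise vertex bound: `|V x z κ₁ κ₂| ≤ Cs · Σ'_u a(u) e^{−m′‖x−u‖₁} e^{−m′‖z−u‖₁}`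
  have hSs : ∀ x z κ₁ κ₂, ∀ κ, Summable fun u => S κ u x z (Sum.inl κ₁) (Sum.inl κ₂) := fun x z κ₁ κ₂ κ => summable_slot hCs hm hω hS κ x z _ _
  have hw : ∀ z u : Site (d + 1), 0 ≤ Real.exp (-m' * l1 (z - u)) ∧ Real.exp (-m' * l1 (z - u)) ≤ 1 := fun z u =>
    ⟨Real.exp_nonneg _, Real.exp_le_one_iff.2 (by nlinarith [l1_nonneg (z - u)])⟩
  have hV : ∀ x z κ₁ κ₂, |vertexW (fun ν U κ u => dz (lam ν U) κ u) S ν U x z (Sum.inl κ₁) (Sum.inl κ₂)|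
      ≤ Cs * ∑' u, a u * Real.exp (-m' * l1 (x - u)) * Real.exp (-m' * l1 (z - u)) := by
    intro x z κ₁ κ₂
    have hmaj : Summable fun u => |lam ν U u - c| * ((Real.exp (2 * m') * (∑ κ : Fin (d + 1), ω (u - AffineAveraging.unitVec κ)) + ((d : ℝ) + 1) * ω u)
        * Real.exp (-m' * (l1 (x - u) + l1 (z - u)))) := by
      refine Summable.of_norm_bounded hmass (fun u => ?_)
      rw [Real.norm_eq_abs, abs_of_nonneg (mul_nonneg (abs_nonneg _) (mul_nonneg ?_ (Real.exp_nonneg _)))]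
      · rw [← mul_assoc]
        exact mul_le_of_le_one_right (ha u) (Real.exp_le_one_iff.2 (by nlinarith [l1_nonneg (x - u), l1_nonneg (z - u)]))
      · exact add_nonneg (mul_nonneg (Real.exp_nonneg _) (Finset.sum_nonneg fun κ _ => (hω _).1)) (mul_nonneg (by positivity) (hω u).1)
    refine (abs_vertexW_dz_le_of_profile hlam hCs hm.le (fun u => (hω u).1) hS (hSs x z κ₁ κ₂) ν U c hmaj).trans (le_of_eq ?_)
    congr 1
    refine tsum_congr fun u => ?_
    rw [ha_def, mul_add (-m'), Real.exp_add]; ring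
  -- Fubini data for the inner (`x`) and outer (`z`) exchanges
  have hFx : ∀ z, (∀ x, Summable fun u => a u * Real.exp (-m' * l1 (x - u)) * Real.exp (-m' * l1 (z - u))) ∧
      (Summable fun x => ∑' u, a u * Real.exp (-m' * l1 (x - u)) * Real.exp (-m' * l1 (z - u))) ∧
      ∑' x : Site (d + 1), ∑' u : Site (d + 1), a u * Real.exp (-m' * l1 (x - u)) * Real.exp (-m' * l1 (z - u))
        = Zl (d + 1) m' * ∑' u, a u * Real.exp (-m' * l1 (z - u)) :=
    fun z => tsum_tsum_weight hm ha hmass (fun u => (hw z u).1) (fun u => (hw z u).2)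
  have hFz := tsum_tsum_one hm ha hmass
  -- inner series in `x`
  have hinner : ∀ z κ₂, |∑' x : Site (d + 1), ∑ κ₁ : Fin (d + 1), l α x' κ₁ x * vertexW (fun ν U κ u => dz (lam ν U) κ u) S ν U x z (Sum.inl κ₁) (Sum.inl κ₂)|
      ≤ ((d : ℝ) + 1) * Cl * Cs * (Zl (d + 1) m' * ∑' u, a u * Real.exp (-m' * l1 (z - u))) := by
    intro z κ₂
    obtain ⟨h1, h2, h3⟩ := hFx z
    rw [← h3, ← tsum_mul_left, ← Real.norm_eq_abs]
    refine tsum_of_norm_bounded ((h2.mul_left _).hasSum) (fun x => ?_)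
    rw [Real.norm_eq_abs]
    refine (Finset.abs_sum_le_sum_abs _ _).trans ?_
    have hterm : ∀ κ₁ : Fin (d + 1), |l α x' κ₁ x * vertexW (fun ν U κ u => dz (lam ν U) κ u) S ν U x z (Sum.inl κ₁) (Sum.inl κ₂)|
        ≤ Cl * (Cs * ∑' u, a u * Real.exp (-m' * l1 (x - u)) * Real.exp (-m' * l1 (z - u))) := fun κ₁ => by
      rw [abs_mul]
      exact mul_le_mul (hl α x' κ₁ x) (hV x z κ₁ κ₂) (abs_nonneg _) hCl
    refine (Finset.sum_le_sum fun κ₁ _ => hterm κ₁).trans (le_of_eq ?_)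
    rw [Finset.sum_const, Finset.card_univ, Fintype.card_fin, nsmul_eq_mul, Nat.cast_add, Nat.cast_one]
    ring
  -- outer series in `z`
  rw [push₃_inl_inl, ← Real.norm_eq_abs]
  obtain ⟨g1, g2, g3⟩ := hFz
  have hmajz : Summable fun z => ((d : ℝ) + 1) * (((d : ℝ) + 1) * Cl * Cs * (Zl (d + 1) m' * ∑' u, a u * Real.exp (-m' * l1 (z - u)))) * Cr := by
    have := (g2.mul_left (((d : ℝ) + 1) * (((d : ℝ) + 1) * Cl * Cs * Zl (d + 1) m'))).mul_right Cr
    refine this.congr fun z => ?_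
    ring
  refine (tsum_of_norm_bounded hmajz.hasSum (fun z => ?_)).trans (le_of_eq ?_)
  · rw [Real.norm_eq_abs]
    refine (Finset.abs_sum_le_sum_abs _ _).trans ?_
    have hterm : ∀ κ₂ : Fin (d + 1), |(∑' x : Site (d + 1), ∑ κ₁ : Fin (d + 1),
        l α x' κ₁ x * vertexW (fun ν U κ u => dz (lam ν U) κ u) S ν U x z (Sum.inl κ₁) (Sum.inl κ₂)) * r β z' κ₂ z|
        ≤ (((d : ℝ) + 1) * Cl * Cs * (Zl (d + 1) m' * ∑' u, a u * Real.exp (-m' * l1 (z - u)))) * Cr := fun κ₂ => by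
      rw [abs_mul]
      refine mul_le_mul (hinner z κ₂) (hr β z' κ₂ z) (abs_nonneg _) ?_
      exact mul_nonneg (mul_nonneg (mul_nonneg (by positivity) hCl) hCs)
        (mul_nonneg (Zl_nonneg hm) (tsum_nonneg fun u => mul_nonneg (ha u) (Real.exp_nonneg _)))
    refine (Finset.sum_le_sum fun κ₂ _ => hterm κ₂).trans (le_of_eq ?_)
    rw [Finset.sum_const, Finset.card_univ, Fintype.card_fin, nsmul_eq_mul, Nat.cast_add, Nat.cast_one]
    ring
  · have e : ∀ z, ((d : ℝ) + 1) * (((d : ℝ) + 1) * Cl * Cs * (Zl (d + 1) m' * ∑' u, a u * Real.exp (-m' * l1 (z - u)))) * Cr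
        = (((d : ℝ) + 1) ^ 2 * Cl * Cr * Cs * Zl (d + 1) m') * ∑' u, a u * Real.exp (-m' * l1 (z - u)) := fun z => by ring
    rw [tsum_congr e, tsum_mul_left, g3]
    ring

end Cell

end Summit.QuantumFields.BalabanUV.Beta.GAN24.GaugeTableCellByParts

end
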